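import Mathlib
import Literature.NumberTheory.LFunctions.KloostermanPrimePowerTools
import HarnessLib

/-!
# Kloosterman sums to odd prime-power moduli: the Salié bound `|S(1, b; p^K)| ≤ 2 p^{K/2}` — PROVED

Topic `NumberTheory/LFunctions` (exponential sums); fourth file on
`Literature.NumberTheory.LFunctions.kloostermanSum`.  For an odd prime `p`, `K ≥ 2` and a unit `b`
modulo `p^K` we PROVE `‖S(1, b; p^K)‖ ≤ 2 (p^K)^{1/2}` (`norm_kloostermanSum_one_le_two_sqrt`),
the prime-power case of Weil's bound (2.25) [cite: Iwaniec2002, §2.5 (2.25)] with the constant `2`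
(Salié 1932; Iwaniec–Kowalski §12.3), by the `p`-adic stationary phase:

* even `K = 2k`: `x = u + p^k v`; the sum over `v` forces `u² ≡ b (mod p^k)`, which has at most
  two solutions for odd `p` (`card_filter_sqrt_le_two`), whence `|S| ≤ 2 p^k`
  (`norm_kloostermanSum_one_le_two_mul_pow`, the odd-`p` sharpening of
  `norm_kloostermanSum_one_le`);
* odd `K = 2l + 1`: `x = u + p^{l+1} v` leaves `u mod p^{l+1}` with `u² ≡ b (mod p^l)`, i.e.
  `u = w + p^l t` with `w² ≡ b (mod p^l)` (at most two `w`) and `t mod p`; expanding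
  `(w + p^l t)⁻¹` to second order (`inv_add_mul_of_cube_eq_zero`) the phase becomes
  `e((w + b w̄)/p^K) e((s t + b w̄³ t²)/p)` with `1 − b w̄² = p^l s`, and the sum over `t` is a
  quadratic Gauss sum of modulus exactly `√p` (`norm_quadGaussSum`, by the classical double
  counting `|G|² = ∑_h e(…) ∑_{t'} e(2γ h t'/p) = p`), whence `|S| ≤ 2 p^l √p`.

## References

* H. Salié, *Über die Kloostermanschen Summen S(u, v; q)*, Math. Z. 34 (1932) 91–109.
* H. Iwaniec, E. Kowalski, *Analytic Number Theory* (2004), §12.3.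
* H. Iwaniec, *Spectral Methods of Automorphic Forms*, 2nd ed. (2002), §2.5 (`Iwaniec2002`).
-/

noncomputable section

open Finset

namespace Literature.NumberTheory.LFunctions

section PrimePow

variable {p : ℕ} [hp : Fact p.Prime]

/-! ### Odd `p`: at most two square roots, and the even-exponent bound with constant `2` -/

/-- For odd `p`, the units `w` of `ℤ/p^lℤ` with `c w⁻² = 1` (i.e. `w² = c`) number at most `2`.
[folklore] -/
theorem card_filter_sqrt_le_two (hp2 : p ≠ 2) (l : ℕ) (c : ZMod (p ^ l)) :
    (Finset.univ.filter fun w : ZMod (p ^ l) ↦ IsUnit w ∧ c * w⁻¹ ^ 2 = 1).card ≤ 2 := by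
  classical
  by_cases hex : ∃ w₀ : ZMod (p ^ l), IsUnit w₀ ∧ c * w₀⁻¹ ^ 2 = 1
  swap
  · rw [Finset.filter_false_of_mem, Finset.card_empty]
    · exact Nat.zero_le _
    · exact fun w _ hw ↦ hex ⟨w, hw⟩
  obtain ⟨w₀, hw₀, hc₀⟩ := hex
  have hsq : ∀ w : ZMod (p ^ l), IsUnit w ∧ c * w⁻¹ ^ 2 = 1 → w ^ 2 = w₀ ^ 2 := by
    rintro w ⟨hw, hc⟩
    have h1 : w₀⁻¹ * w₀ = 1 := ZMod.inv_mul_of_unit w₀ hw₀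
    have h2 : w⁻¹ * w = 1 := ZMod.inv_mul_of_unit w hw
    have hc' : c = w₀ ^ 2 := by
      linear_combination (-c * (w₀⁻¹ * w₀ + 1)) * h1 + w₀ ^ 2 * hc₀
    linear_combination (-w ^ 2) * hc + (c * (w⁻¹ * w + 1)) * h2 + hc'
  calc _ ≤ ({w₀, -w₀} : Finset (ZMod (p ^ l))).card := by
        refine Finset.card_le_card fun w hw ↦ ?_
        rw [Finset.mem_filter] at hw
        simp only [Finset.mem_insert, Finset.mem_singleton]
        rcases eq_or_eq_neg_of_sq_eq_sq_of_odd hp2 hw₀ (hsq w hw.2) with h | h <;>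
          simp only [h, true_or, or_true]
    _ ≤ 2 := Finset.card_le_two

/-- **Odd `p`: `|S(1, b; p^m)| ≤ 2 p^{⌈m/2⌉}`** (the proof of `norm_kloostermanSum_one_le` with the
sharper root count for odd `p`). [folklore] -/
theorem norm_kloostermanSum_one_le_two_mul_pow (hp2 : p ≠ 2) (m : ℕ) (b : ZMod (p ^ m)) :
    ‖kloostermanSum (p ^ m) 1 b‖ ≤ 2 * (p : ℝ) ^ (m - m / 2) := by
  classical
  set k := m - m / 2 with hk
  set l := m / 2 with hl
  have hklm : k + l = m := by omega
  have hlk : l ≤ k := by omega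
  have hm2 : m ≤ 2 * k := by omega
  have hk0 : m = 0 ∨ k ≠ 0 := by omega
  have hdvd : p ^ l ∣ p ^ m := pow_dvd_pow p (by omega)
  set π := ZMod.castHom hdvd (ZMod (p ^ l)) with hπ
  set Q : ZMod (p ^ l) → Prop := fun w ↦ IsUnit w ∧ π b * w⁻¹ ^ 2 = 1 with hQ
  rw [kloostermanSum_one_stationary hklm hm2 hk0 b]
  -- norms
  have hnorm : ‖∑ u ∈ range (p ^ k), (if IsUnit ((u : ℕ) : ZMod (p ^ m)) then
      (ZMod.stdAddChar (((u : ℕ) : ZMod (p ^ m)) + b * ((u : ℕ) : ZMod (p ^ m))⁻¹) : ℂ) *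
        (if ZMod.castHom hdvd (ZMod (p ^ l)) (1 - b * ((u : ℕ) : ZMod (p ^ m))⁻¹ ^ 2) = 0
          then ((p ^ l : ℕ) : ℂ) else 0) else 0)‖ ≤
      ∑ u ∈ range (p ^ k), if Q (u : ZMod (p ^ l)) then ((p ^ l : ℕ) : ℝ) else 0 := by
    refine (norm_sum_le _ _).trans (Finset.sum_le_sum fun u _ ↦ ?_)
    by_cases hu : IsUnit ((u : ℕ) : ZMod (p ^ m))
    · rw [if_pos hu]
      by_cases h0 : ZMod.castHom hdvd (ZMod (p ^ l)) (1 - b * ((u : ℕ) : ZMod (p ^ m))⁻¹ ^ 2) = 0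
      · have hQu : Q (u : ZMod (p ^ l)) := by
          refine ⟨?_, ?_⟩
          · have := hu.map π
            rwa [hπ, ZMod.castHom_apply, ZMod.cast_natCast hdvd] at this
          · rw [map_sub, map_one, map_mul, map_pow, sub_eq_zero, ZMod.castHom_apply,
              ZMod.castHom_apply, ZMod.cast_inv_of_isUnit hdvd hu,
              ZMod.cast_natCast hdvd] at h0
            rw [hπ, ZMod.castHom_apply]
            exact h0.symm
        rw [if_pos h0, if_pos hQu, norm_mul, norm_stdAddChar, one_mul, Complex.norm_natCast]
      · rw [if_neg h0, mul_zero, norm_zero]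
        split_ifs <;> positivity
    · rw [if_neg hu, norm_zero]
      split_ifs <;> positivity
  -- counting
  have hcount : ∑ u ∈ range (p ^ k), (if Q (u : ZMod (p ^ l)) then ((p ^ l : ℕ) : ℝ) else 0) ≤
      ((p ^ l : ℕ) : ℝ) * (p ^ (k - l) * 2) := by
    rw [← Finset.sum_filter, Finset.sum_const, nsmul_eq_mul, mul_comm,
      card_filter_range_pow_eq hlk Q]
    gcongr
    exact_mod_cast Nat.mul_le_mul_left _ (card_filter_sqrt_le_two hp2 l (π b))
  refine hnorm.trans (hcount.trans (le_of_eq ?_))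
  rw [show (p : ℝ) ^ k = (p : ℝ) ^ l * (p : ℝ) ^ (k - l) by
    rw [← pow_add, Nat.add_sub_cancel' hlk]]
  push_cast
  ring

/-! ### The quadratic Gauss sum modulo `p` has modulus `√p` (double counting) -/

/-- **The quadratic Gauss sum**: for odd `p`, `γ` a unit and any `σ` modulo `p`,
`|∑_{t mod p} e((γ t² + σ t)/p)| = √p`.  Proof: `|G|² = ∑_{h} e((γh² + σh)/p) ∑_{t'} e(2γh t'/p)`
and the inner sum vanishes unless `h = 0`. [folklore] -/
theorem norm_quadGaussSum (hp2 : p ≠ 2) {γ : ZMod (p ^ 1)} (hγ : IsUnit γ) (σ : ZMod (p ^ 1)) :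
    ‖∑ t : ZMod (p ^ 1), (ZMod.stdAddChar (γ * t ^ 2 + σ * t) : ℂ)‖ = Real.sqrt p := by
  classical
  set ψ : ZMod (p ^ 1) → ℂ := fun x ↦ (ZMod.stdAddChar x : ℂ) with hψ
  set f : ZMod (p ^ 1) → ZMod (p ^ 1) := fun t ↦ γ * t ^ 2 + σ * t with hf
  set G : ℂ := ∑ t : ZMod (p ^ 1), ψ (f t) with hG
  -- `2γ` is a unit
  have h2 : IsUnit ((2 : ℕ) : ZMod (p ^ 1)) := by
    rw [isUnit_natCast_iff_not_dvd one_ne_zero]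
    intro h
    exact hp2 ((Nat.prime_dvd_prime_iff_eq hp.out Nat.prime_two).mp h)
  have h2γ : IsUnit (2 * γ) := by
    have : (2 : ZMod (p ^ 1)) = ((2 : ℕ) : ZMod (p ^ 1)) := by norm_num
    rw [this]; exact h2.mul hγ
  -- `G conj G = p`
  have hconj : starRingEnd ℂ G = ∑ t : ZMod (p ^ 1), ψ (-f t) := by
    rw [hG, map_sum]
    exact Finset.sum_congr rfl fun t _ ↦ (AddChar.map_neg_eq_conj ZMod.stdAddChar (f t)).symm
  have hkey : G * starRingEnd ℂ G = (p : ℂ) := by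
    rw [hconj, hG, Finset.sum_mul_sum]
    -- `ψ(f t) ψ(−f t') = ψ(f t − f t')`, and `t = t' + h`
    have h1 : ∑ t : ZMod (p ^ 1), ∑ t' : ZMod (p ^ 1), ψ (f t) * ψ (-f t') =
        ∑ t' : ZMod (p ^ 1), ∑ h : ZMod (p ^ 1), ψ (f (t' + h) - f t') := by
      rw [Finset.sum_comm]
      refine Finset.sum_congr rfl fun t' _ ↦ ?_
      refine (Fintype.sum_equiv (Equiv.addLeft t') (fun h ↦ ψ (f (t' + h) - f t'))
        (fun t ↦ ψ (f t) * ψ (-f t')) fun h ↦ ?_).symm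
      simp only [Equiv.coe_addLeft, hψ]
      rw [← AddChar.map_add_eq_mul, sub_eq_add_neg]
    have h2' : ∀ t' h : ZMod (p ^ 1), f (t' + h) - f t' = t' * (2 * γ * h) + (γ * h ^ 2 + σ * h) := by
      intro t' h; simp only [hf]; ring
    have h3 : ∑ t' : ZMod (p ^ 1), ∑ h : ZMod (p ^ 1), ψ (f (t' + h) - f t') =
        ∑ h : ZMod (p ^ 1), ψ (γ * h ^ 2 + σ * h) *
          ∑ t' : ZMod (p ^ 1), (ZMod.stdAddChar (t' * (2 * γ * h)) : ℂ) := by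
      rw [Finset.sum_comm]
      refine Finset.sum_congr rfl fun h _ ↦ ?_
      rw [Finset.mul_sum]
      refine Finset.sum_congr rfl fun t' _ ↦ ?_
      rw [h2', hψ]
      dsimp only
      rw [AddChar.map_add_eq_mul, mul_comm]
    rw [h1, h3]
    have h4 : ∀ h : ZMod (p ^ 1), ∑ t' : ZMod (p ^ 1), (ZMod.stdAddChar (t' * (2 * γ * h)) : ℂ) =
        if h = 0 then ((p ^ 1 : ℕ) : ℂ) else 0 := by
      intro h
      rw [AddChar.sum_mulShift _ (ZMod.isPrimitive_stdAddChar (p ^ 1)), ZMod.card, Nat.cast_ite,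
        Nat.cast_zero]
      simp only [h2γ.mul_right_eq_zero]
    simp_rw [h4, mul_ite, mul_zero]
    rw [Finset.sum_ite_eq' Finset.univ (0 : ZMod (p ^ 1))
      (fun h ↦ ψ (γ * h ^ 2 + σ * h) * ((p ^ 1 : ℕ) : ℂ)), if_pos (Finset.mem_univ _)]
    rw [show γ * (0 : ZMod (p ^ 1)) ^ 2 + σ * 0 = 0 by ring, hψ]
    dsimp only
    rw [AddChar.map_zero_eq_one, one_mul]
    norm_num
  -- `‖G‖² = p`
  have hnormsq : ‖G‖ ^ 2 = p := by
    have h := Complex.mul_conj G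
    rw [hkey] at h
    have h' : ((Complex.normSq G : ℝ) : ℂ) = ((p : ℝ) : ℂ) := by
      rw [← h]; norm_cast
    have h'' : Complex.normSq G = p := by exact_mod_cast h'
    rw [← Complex.normSq_eq_norm_sq, h'']
  rw [← Real.sqrt_sq (norm_nonneg G), hnormsq]

/-! ### Odd exponent `K = 2l + 1`: second-order stationary phase -/

omit hp in
/-- **Inverse to second order**: if `P³ = 0` in `ℤ/qℤ` and `u` is a unit, then
`(u + P v)⁻¹ = u⁻¹ − P v u⁻² + P² v² u⁻³`. [folklore] -/
theorem ZMod.inv_add_mul_of_cube_eq_zero {q : ℕ} {u P : ZMod q} (hu : IsUnit u) (hP : P ^ 3 = 0)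
    (v : ZMod q) : (u + P * v)⁻¹ = u⁻¹ - P * v * u⁻¹ ^ 2 + P ^ 2 * v ^ 2 * u⁻¹ ^ 3 := by
  apply ZMod.inv_eq_of_mul_eq_one
  have huu : u * u⁻¹ = 1 := ZMod.mul_inv_of_unit u hu
  linear_combination (1 - P * v * u⁻¹ + P ^ 2 * v ^ 2 * u⁻¹ ^ 2) * huu + (v ^ 3 * u⁻¹ ^ 3) * hP

omit hp in
/-- **The phase to second order**: with `1 − b u⁻² = P s` and `P³ = 0`,
`(u + Pv) + b (u + Pv)⁻¹ = (u + b u⁻¹) + P² (s v + b u⁻³ v²)`. [folklore] -/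
theorem kloosterman_phase_second_order {q : ℕ} {u P b s : ZMod q} (hu : IsUnit u)
    (hP : P ^ 3 = 0) (hs : 1 - b * u⁻¹ ^ 2 = P * s) (v : ZMod q) :
    (u + P * v) + b * (u + P * v)⁻¹ = (u + b * u⁻¹) + P ^ 2 * (s * v + b * u⁻¹ ^ 3 * v ^ 2) := by
  rw [ZMod.inv_add_mul_of_cube_eq_zero hu hP v]
  linear_combination (P * v) * hs

/-- The kernel of `ℤ/p^Kℤ → ℤ/p^lℤ` is generated by `p^l`. [folklore] -/
theorem exists_eq_pow_mul_of_castHom_eq_zero {l K : ℕ} (h : p ^ l ∣ p ^ K) {y : ZMod (p ^ K)}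
    (hy : ZMod.castHom h (ZMod (p ^ l)) y = 0) :
    ∃ s : ZMod (p ^ K), y = ((p ^ l : ℕ) : ZMod (p ^ K)) * s := by
  have hy' : y = ((y.val : ℕ) : ZMod (p ^ K)) := (ZMod.natCast_zmod_val y).symm
  rw [hy', map_natCast, ZMod.natCast_eq_zero_iff] at hy
  obtain ⟨j, hj⟩ := hy
  exact ⟨(j : ZMod (p ^ K)), by rw [hy', hj]; push_cast; ring⟩

/-- `e(p^{2l} z / p^{2l+1}) = e((z mod p)/p)`. [folklore] -/
theorem stdAddChar_pow_sq_mul (l : ℕ) (z : ZMod (p ^ (2 * l + 1))) :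
    (ZMod.stdAddChar ((((p ^ l : ℕ) : ZMod (p ^ (2 * l + 1))) ^ 2 * z)) : ℂ) =
      ZMod.stdAddChar (ZMod.castHom (pow_dvd_pow p (by omega : 1 ≤ 2 * l + 1))
        (ZMod (p ^ 1)) z) := by
  have hz : z = ((z.val : ℕ) : ZMod (p ^ (2 * l + 1))) := (ZMod.natCast_zmod_val z).symm
  rw [hz, map_natCast, show ((p ^ l : ℕ) : ZMod (p ^ (2 * l + 1))) ^ 2 *
      ((z.val : ℕ) : ZMod (p ^ (2 * l + 1))) = ((p ^ (2 * l) * z.val : ℕ) : ZMod (p ^ (2 * l + 1)))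
      by push_cast; ring]
  exact stdAddChar_pow_mul_natCast (k := 2 * l) (l := 1) (m := 2 * l + 1) rfl z.val

set_option maxHeartbeats 800000 in
/-- **The inner sum for one admissible `w`** (odd exponent `2l + 1`, `l ≥ 1`): if `w` is a unit with
`b w̄² ≡ 1 (mod p^l)`, then `∑_{t < p} e(((w + p^l t) + b (w + p^l t)⁻¹)/p^{2l+1})` has modulus
exactly `√p` (it is `e((w + b w̄)/p^{2l+1})` times a quadratic Gauss sum modulo `p`). [folklore] -/
theorem norm_inner_sum_eq_sqrt (hp2 : p ≠ 2) {l : ℕ} (hl : 1 ≤ l) {b : ZMod (p ^ (2 * l + 1))}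
    (hb : IsUnit b) (w : ℕ) (hw : IsUnit ((w : ℕ) : ZMod (p ^ (2 * l + 1))))
    (h0 : ZMod.castHom (pow_dvd_pow p (by omega : l ≤ 2 * l + 1)) (ZMod (p ^ l))
      (1 - b * ((w : ℕ) : ZMod (p ^ (2 * l + 1)))⁻¹ ^ 2) = 0) :
    ‖∑ t ∈ range p, (ZMod.stdAddChar (((w + p ^ l * t : ℕ) : ZMod (p ^ (2 * l + 1))) +
        b * ((w + p ^ l * t : ℕ) : ZMod (p ^ (2 * l + 1)))⁻¹) : ℂ)‖ = Real.sqrt p := by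
  classical
  set W : ZMod (p ^ (2 * l + 1)) := ((w : ℕ) : ZMod (p ^ (2 * l + 1))) with hW
  set Pl : ZMod (p ^ (2 * l + 1)) := ((p ^ l : ℕ) : ZMod (p ^ (2 * l + 1))) with hPl
  set π₁ := ZMod.castHom (pow_dvd_pow p (by omega : 1 ≤ 2 * l + 1)) (ZMod (p ^ 1)) with hπ₁
  obtain ⟨s, hs⟩ := exists_eq_pow_mul_of_castHom_eq_zero _ h0
  have hP3 : Pl ^ 3 = 0 := by
    rw [hPl, ← Nat.cast_pow, ZMod.natCast_eq_zero_iff, ← pow_mul]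
    exact pow_dvd_pow p (by omega)
  -- the unit `c = b w̄³` and its reduction `γ`
  obtain ⟨uw, huw⟩ := hw
  have hWinv : W⁻¹ = ((uw⁻¹ : (ZMod (p ^ (2 * l + 1)))ˣ) : ZMod (p ^ (2 * l + 1))) := by
    rw [← huw, ZMod.inv_coe_unit]
  have hc : IsUnit (b * W⁻¹ ^ 3) := by
    rw [hWinv]; exact hb.mul ((Units.isUnit _).pow 3)
  have hγ : IsUnit (π₁ (b * W⁻¹ ^ 3)) := hc.map π₁
  -- each phase
  have hphase : ∀ t : ℕ, (ZMod.stdAddChar (((w + p ^ l * t : ℕ) : ZMod (p ^ (2 * l + 1))) +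
      b * ((w + p ^ l * t : ℕ) : ZMod (p ^ (2 * l + 1)))⁻¹) : ℂ) =
      ZMod.stdAddChar (W + b * W⁻¹) *
        ZMod.stdAddChar (π₁ (b * W⁻¹ ^ 3) * ((t : ℕ) : ZMod (p ^ 1)) ^ 2 +
          π₁ s * ((t : ℕ) : ZMod (p ^ 1))) := by
    intro t
    have hx : ((w + p ^ l * t : ℕ) : ZMod (p ^ (2 * l + 1))) = W + Pl * ((t : ℕ) : ZMod _) := by
      rw [hW, hPl]; push_cast; ring
    rw [hx, kloosterman_phase_second_order ⟨uw, huw⟩ hP3 hs, AddChar.map_add_eq_mul, hPl,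
      stdAddChar_pow_sq_mul l, map_add π₁, map_mul π₁, map_mul π₁, map_mul π₁, map_pow π₁,
      map_pow π₁, map_natCast π₁]
    congr 2
    ring
  simp_rw [hphase]
  rw [← Finset.mul_sum, norm_mul, norm_stdAddChar, one_mul,
    show range p = range (p ^ 1) by rw [pow_one],
    ← sum_zmod_eq_sum_range (fun t : ZMod (p ^ 1) =>
      (ZMod.stdAddChar (π₁ (b * W⁻¹ ^ 3) * t ^ 2 + π₁ s * t) : ℂ))]
  exact norm_quadGaussSum hp2 hγ (π₁ s)

set_option maxHeartbeats 800000 in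
/-- **Odd exponent**: for odd `p`, `l ≥ 1` and a unit `b`, `|S(1, b; p^{2l+1})| ≤ 2 p^l √p`.
[folklore] -/
theorem norm_kloostermanSum_one_le_odd (hp2 : p ≠ 2) {l : ℕ} (hl : 1 ≤ l)
    {b : ZMod (p ^ (2 * l + 1))} (hb : IsUnit b) :
    ‖kloostermanSum (p ^ (2 * l + 1)) 1 b‖ ≤ 2 * (p : ℝ) ^ l * Real.sqrt p := by
  classical
  have hklm : (l + 1) + l = 2 * l + 1 := by ring
  have hdl : p ^ l ∣ p ^ (2 * l + 1) := pow_dvd_pow p (by omega)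
  rw [kloostermanSum_one_stationary (k := l + 1) (l := l) (m := 2 * l + 1) hklm (by omega)
    (Or.inr (by omega)) b, show range (p ^ (l + 1)) = range (p ^ l * p) by rw [pow_succ],
    sum_range_mul_eq_sum_sum]
  set π := ZMod.castHom hdl (ZMod (p ^ l)) with hπ
  set Q : ZMod (p ^ l) → Prop := fun y ↦ IsUnit y ∧ π b * y⁻¹ ^ 2 = 1 with hQ
  -- per-`w` bound
  have hw_bound : ∀ w ∈ range (p ^ l),
      ‖∑ t ∈ range p, (if IsUnit ((((w + p ^ l * t : ℕ)) : ℕ) : ZMod (p ^ (2 * l + 1))) then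
        (ZMod.stdAddChar ((((w + p ^ l * t : ℕ) : ℕ) : ZMod (p ^ (2 * l + 1))) +
          b * ((((w + p ^ l * t : ℕ) : ℕ) : ZMod (p ^ (2 * l + 1))))⁻¹) : ℂ) *
          (if ZMod.castHom hdl (ZMod (p ^ l))
              (1 - b * ((((w + p ^ l * t : ℕ) : ℕ) : ZMod (p ^ (2 * l + 1))))⁻¹ ^ 2) = 0
            then ((p ^ l : ℕ) : ℂ) else 0) else 0)‖ ≤
        if Q ((w : ℕ) : ZMod (p ^ l)) then (p : ℝ) ^ l * Real.sqrt p else 0 := by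
    intro w _
    have hrhs : 0 ≤ (if Q ((w : ℕ) : ZMod (p ^ l)) then (p : ℝ) ^ l * Real.sqrt p else 0) := by
      split_ifs <;> positivity
    -- reductions mod `p^l` do not see `t`
    have hred : ∀ t : ℕ, ZMod.castHom hdl (ZMod (p ^ l)) (((w + p ^ l * t : ℕ)) : ZMod (p ^ (2 * l + 1))) =
        ZMod.castHom hdl (ZMod (p ^ l)) ((w : ℕ) : ZMod (p ^ (2 * l + 1))) := by
      intro t
      rw [map_natCast, map_natCast, Nat.cast_add, Nat.cast_mul, ZMod.natCast_self, zero_mul,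
        add_zero]
    have hunit : ∀ t : ℕ, IsUnit (((w + p ^ l * t : ℕ)) : ZMod (p ^ (2 * l + 1))) ↔
        IsUnit ((w : ℕ) : ZMod (p ^ (2 * l + 1))) := fun t =>
      isUnit_natCast_add_pow_mul_iff (Or.inr (by omega)) w t
    by_cases hw : IsUnit ((w : ℕ) : ZMod (p ^ (2 * l + 1)))
    · have hcond : ∀ t : ℕ, ZMod.castHom hdl (ZMod (p ^ l))
          (1 - b * ((((w + p ^ l * t : ℕ) : ℕ) : ZMod (p ^ (2 * l + 1))))⁻¹ ^ 2) =
          ZMod.castHom hdl (ZMod (p ^ l)) (1 - b * ((w : ℕ) : ZMod (p ^ (2 * l + 1)))⁻¹ ^ 2) := by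
        intro t
        have h1 : ZMod.castHom hdl (ZMod (p ^ l)) ((((w + p ^ l * t : ℕ) : ℕ) : ZMod (p ^ (2 * l + 1))))⁻¹ =
            ZMod.castHom hdl (ZMod (p ^ l)) (((w : ℕ) : ZMod (p ^ (2 * l + 1))))⁻¹ := by
          rw [ZMod.castHom_apply, ZMod.castHom_apply, ZMod.cast_inv_of_isUnit hdl ((hunit t).mpr hw),
            ZMod.cast_inv_of_isUnit hdl hw, ← ZMod.castHom_apply (h := hdl) (R := ZMod (p ^ l)),
            ← ZMod.castHom_apply (h := hdl) (R := ZMod (p ^ l)), hred t]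
        rw [map_sub, map_sub, map_mul, map_mul, map_pow, map_pow, h1]
      by_cases h0 : ZMod.castHom hdl (ZMod (p ^ l))
          (1 - b * ((w : ℕ) : ZMod (p ^ (2 * l + 1)))⁻¹ ^ 2) = 0
      · -- the admissible case: Gauss sum
        have hQw : Q ((w : ℕ) : ZMod (p ^ l)) := by
          refine ⟨?_, ?_⟩
          · have := hw.map π
            rwa [hπ, ZMod.castHom_apply, ZMod.cast_natCast hdl] at this
          · have h0' := h0
            rw [map_sub, map_one, map_mul, map_pow, sub_eq_zero, ZMod.castHom_apply,
              ZMod.castHom_apply, ZMod.cast_inv_of_isUnit hdl hw, ZMod.cast_natCast hdl] at h0'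
            rw [hπ, ZMod.castHom_apply]
            exact h0'.symm
        rw [if_pos hQw]
        have hsum : ∑ t ∈ range p, (if IsUnit ((((w + p ^ l * t : ℕ)) : ℕ) : ZMod (p ^ (2 * l + 1))) then
            (ZMod.stdAddChar ((((w + p ^ l * t : ℕ) : ℕ) : ZMod (p ^ (2 * l + 1))) +
              b * ((((w + p ^ l * t : ℕ) : ℕ) : ZMod (p ^ (2 * l + 1))))⁻¹) : ℂ) *
              (if ZMod.castHom hdl (ZMod (p ^ l))
                  (1 - b * ((((w + p ^ l * t : ℕ) : ℕ) : ZMod (p ^ (2 * l + 1))))⁻¹ ^ 2) = 0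
                then ((p ^ l : ℕ) : ℂ) else 0) else 0) =
            ((p ^ l : ℕ) : ℂ) * ∑ t ∈ range p,
              (ZMod.stdAddChar (((w + p ^ l * t : ℕ) : ZMod (p ^ (2 * l + 1))) +
                b * ((w + p ^ l * t : ℕ) : ZMod (p ^ (2 * l + 1)))⁻¹) : ℂ) := by
          rw [Finset.mul_sum]
          refine Finset.sum_congr rfl fun t _ => ?_
          rw [if_pos ((hunit t).mpr hw), if_pos (show _ = (0 : ZMod (p ^ l)) by rw [hcond t]; exact h0),
            mul_comm]
        rw [hsum, norm_mul, Complex.norm_natCast, norm_inner_sum_eq_sqrt hp2 hl hb w hw h0]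
        push_cast
        exact le_rfl
      · -- `b w̄² ≢ 1`: every term vanishes
        refine le_of_eq_of_le ?_ hrhs
        rw [norm_eq_zero]
        refine Finset.sum_eq_zero fun t _ => ?_
        rw [if_pos ((hunit t).mpr hw), if_neg (fun h => h0 (by rwa [hcond t] at h)), mul_zero]
    · -- `p ∣ w`: every term vanishes
      refine le_of_eq_of_le ?_ hrhs
      rw [norm_eq_zero]
      refine Finset.sum_eq_zero fun t _ => ?_
      rw [if_neg (fun h => hw ((hunit t).mp h))]
  -- sum over `w` and count
  refine (norm_sum_le _ _).trans ((Finset.sum_le_sum hw_bound).trans ?_)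
  rw [← Finset.sum_filter, Finset.sum_const, nsmul_eq_mul, card_filter_range_pow_eq le_rfl Q,
    Nat.sub_self, pow_zero, one_mul]
  have hcard := card_filter_sqrt_le_two hp2 l (π b)
  have h2 : ((Finset.univ.filter Q).card : ℝ) ≤ 2 := by exact_mod_cast hcard
  have h0 : 0 ≤ (p : ℝ) ^ l * Real.sqrt p := by positivity
  nlinarith

/-- **Salié's bound for odd prime powers — PROVED**: for odd `p`, `K ≥ 2` and a unit `b` modulo
`p^K`, `|S(1, b; p^K)| ≤ 2 (p^K)^{1/2}` (the prime-power case of Weil's bound (2.25) with constant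
`2 ≤ τ(p^K) = K + 1`). [cite: Iwaniec2002, §2.5 (2.25)] -/
theorem norm_kloostermanSum_one_le_two_sqrt (hp2 : p ≠ 2) {K : ℕ} (hK : 2 ≤ K)
    {b : ZMod (p ^ K)} (hb : IsUnit b) :
    ‖kloostermanSum (p ^ K) 1 b‖ ≤ 2 * Real.sqrt ((p : ℝ) ^ K) := by
  have hp0 : (0 : ℝ) ≤ p := Nat.cast_nonneg p
  obtain ⟨j, rfl | rfl⟩ := Nat.even_or_odd' K
  · have h := norm_kloostermanSum_one_le_two_mul_pow hp2 (2 * j) b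
    rw [show 2 * j - 2 * j / 2 = j by omega] at h
    refine h.trans (le_of_eq ?_)
    rw [pow_mul', Real.sqrt_sq (by positivity)]
  · have hj : 1 ≤ j := by omega
    refine (norm_kloostermanSum_one_le_odd hp2 hj hb).trans (le_of_eq ?_)
    rw [pow_succ, pow_mul', Real.sqrt_mul (by positivity), Real.sqrt_sq (by positivity)]
    ring

end PrimePow

end Literature.NumberTheory.LFunctions

end
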